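import Mathlib
import Summits.Ventures.PercRepro2.TypedLBBridges

/-!
# The double-attachment class of `o ~ {u, b}` from the two-copy rows (blind cell PercRepro2,
night-3 g16, 2026-08-27; NIGHT3-CERT.md §25.7)

For `e = {o, u}`, `f = {o, b}` typed of type `1` at a mark `o` of typed degree two (the other edges
at `o` pinned closed), the double-attachment class `doubleClass` of `typedCount_two_edges_at_o` is
nonnegative as soon as the cell's two two-copy rows hold for the pair `(b, a₃)`, in both root
orientations: `CrossCount a₁ a₂ b a₃`, `SameCount a₂ a₁ b a₃` (the probe copy with `o, b` on the
side of `a₁`) and `CrossCount a₂ a₁ b a₃`, `SameCount a₁ a₂ b a₃` (the mirror) — on the minors on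
which the two non-probe copies form complementary pairs (`typedCount_eq_sum_spec`).  This file: `u = a₁`,
where only the first two rows act (`doubleClass_lb_nonneg_of_rows`, `superadditivity_lb_of_rows`);
the general statement with `u` arbitrary (the `{U, b}` attachment included) is
`TypedOBClass.lean`.

Route: the three same-colour terms symmetrise to `3 · Σ symKer K₃ (x′, y⁰, w⁰)` over the count with
`e, f` pinned closed; on states `KBsym = probeB(x′; ·, ·)` since the closed copies have `o`
isolated; `probeB_lb` / `probeB_hb` split the probe (by the side of `o` in `x′`) into a
pointwise-nonnegative part and `pdB x′ · 2 · (cross + same)`; the spectator decomposition turns the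
latter into complementary-pair counts of the two kernels, which the rows make nonnegative.
Own work; standard axioms; the rows are hypotheses (the theorems are CONDITIONAL on them).
-/

namespace Summit.Ventures.PercRepro2

namespace CovForm

namespace TypedRed

open OneTyped OProbe Untouched TypedA3

/-! ## The conditional theorem -/

section Main

open Classical

variable {V : Type*} {E : Type*} [Fintype E] [DecidableEq E] {R : Type*} [Field R] [LinearOrder R]
  [IsStrictOrderedRing R]

variable (ends : E → Sym2 V) (o a₁ a₂ a₃ b : V)

/-- **The double-attachment class of `o ~ {a₁, b}` is nonnegative under the two two-copy rows**
`CrossCount a₁ a₂ b a₃` and `SameCount a₂ a₁ b a₃`: for `e = {o, a₁}`, `f = {o, b}` ∈ `F` of type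
`1`, types in `{1, 2}` on `F`, `o` distinct from the other marks, every other edge at `o` pinned
closed and untyped (the class is defined without `e, f ∈ F`; those enter through the identity of
`typedCount_two_edges_at_o` in the corollary). -/
theorem doubleClass_lb_nonneg_of_rows {e f : E} (he : ends e = s(o, a₁)) (hf : ends f = s(o, b))
    (hef : e ≠ f) (ho1 : o ≠ a₁) (ho2 : o ≠ a₂) (ho3 : o ≠ a₃) (hob : o ≠ b)
    (F : Finset E) (z : Config E) (τ : E → ℕ) (hτ : ∀ e' ∈ F, τ e' = 1 ∨ τ e' = 2)
    (hcl : ∀ e', e' ≠ e → e' ≠ f → o ∈ ends e' → e' ∉ F ∧ z e' = false)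
    (hC : CrossCount R ends a₁ a₂ b a₃) (hS : SameCount (R := R) ends a₂ a₁ b a₃) :
    0 ≤ doubleClass F z τ e f (K3 ends o a₁ a₂ a₃ b : Config E → Config E → Config E → R) := by
  set K : Config E → Config E → Config E → R := K3 ends o a₁ a₂ a₃ b with hK
  set F₂ := (F.erase e).erase f with hF₂
  set z₂ := Function.update (Function.update z e false) f false with hz₂
  have hτ₂ : ∀ e' ∈ F₂, τ e' = 1 ∨ τ e' = 2 := fun e' he' =>
    hτ e' (Finset.mem_of_mem_erase (Finset.mem_of_mem_erase he'))
  -- the six permutations of (x′, y⁰, w⁰)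
  set X : Config E → Config E := fun x => upd2 x e f true true with hX
  set Y : Config E → Config E := fun x => upd2 x e f false false with hY
  have t2 : typedCount F₂ z₂ τ (fun x y w => K (Y x) (X y) (Y w)) =
      typedCount F₂ z₂ τ (fun x y w => K (Y y) (X x) (Y w)) :=
    typedCount_swap12 F₂ z₂ τ (fun x y w => K (Y y) (X x) (Y w))
  have t3 : typedCount F₂ z₂ τ (fun x y w => K (Y x) (Y y) (X w)) =
      typedCount F₂ z₂ τ (fun x y w => K (Y y) (Y w) (X x)) := by
    rw [typedCount_swap13 F₂ z₂ τ hτ₂ (fun x y w => K (Y w) (Y y) (X x))]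
    exact typedCount_swap23 F₂ z₂ τ hτ₂ (fun x y w => K (Y y) (Y w) (X x))
  have s1 : typedCount F₂ z₂ τ (fun x y w => K (X x) (Y y) (Y w)) =
      typedCount F₂ z₂ τ (fun x y w => K (X x) (Y w) (Y y)) :=
    (typedCount_swap23 F₂ z₂ τ hτ₂ (fun x y w => K (X x) (Y y) (Y w))).symm
  have s2 : typedCount F₂ z₂ τ (fun x y w => K (Y y) (X x) (Y w)) =
      typedCount F₂ z₂ τ (fun x y w => K (Y w) (X x) (Y y)) :=
    (typedCount_swap23 F₂ z₂ τ hτ₂ (fun x y w => K (Y y) (X x) (Y w))).symm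
  have s3 : typedCount F₂ z₂ τ (fun x y w => K (Y y) (Y w) (X x)) =
      typedCount F₂ z₂ τ (fun x y w => K (Y w) (Y y) (X x)) :=
    (typedCount_swap23 F₂ z₂ τ hτ₂ (fun x y w => K (Y y) (Y w) (X x))).symm
  have hD : 2 * doubleClass F z τ e f K = typedCount F₂ z₂ τ (fun x y w =>
      K (X x) (Y y) (Y w) + K (X x) (Y w) (Y y) + K (Y y) (X x) (Y w) + K (Y y) (Y w) (X x) +
        K (Y w) (X x) (Y y) + K (Y w) (Y y) (X x)) := by
    rw [typedCount_add, typedCount_add, typedCount_add, typedCount_add, typedCount_add]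
    unfold doubleClass term
    rw [← hF₂, ← hz₂]
    have e1 : (fun x y w => K (upd2 x e f true true) (upd2 y e f false false)
        (upd2 w e f false false)) = fun x y w => K (X x) (Y y) (Y w) := rfl
    have e2 : (fun x y w => K (upd2 x e f false false) (upd2 y e f true true)
        (upd2 w e f false false)) = fun x y w => K (Y x) (X y) (Y w) := rfl
    have e3 : (fun x y w => K (upd2 x e f false false) (upd2 y e f false false)
        (upd2 w e f true true)) = fun x y w => K (Y x) (Y y) (X w) := rfl
    rw [e1, e2, e3, t2, t3]
    linear_combination s1 + s2 + s3
  -- the symmetrised kernel on states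
  set S := st ends o a₁ a₂ a₃ b with hSt
  have hsym : typedCount F₂ z₂ τ (fun x y w =>
      K (X x) (Y y) (Y w) + K (X x) (Y w) (Y y) + K (Y y) (X x) (Y w) + K (Y y) (Y w) (X x) +
        K (Y w) (X x) (Y y) + K (Y w) (Y y) (X x)) =
      typedCount F₂ z₂ τ (fun x y w => ((KBsym (S (X x)) (S (Y y)) (S (Y w)) : ℤ) : R)) := by
    refine typedCount_congr_K _ _ _ fun x y w => ?_
    simp only [hK, K3_eq_KB, ← hSt, KBsym]
    push_cast
    ring
  -- on the support the closed copies have `o` isolated and the probe copy has `o ~ a₁`, `o ~ b`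
  have hiso : ∀ (x : Config E), (∀ e', e' ∉ F₂ → x e' = z₂ e') →
      (S (Y x)).Lo = false ∧ (S (Y x)).Ho = false := by
    intro x hx
    have hx' := (support_closed ends o F z hcl hef x hx).1
    have := st_two_closed_e ends o a₁ a₂ a₃ b he ho1 hef ho1 ho2 ho3 hob hx'
    simp only [hY, upd2, hSt]
    rw [this]
    exact ⟨killO_Lo _, killO_Ho _⟩
  have hconnX : ∀ x : Config E, Conn ends (X x) a₁ o ∧ Conn ends (X x) o b := by
    intro x
    refine ⟨conn_symm (conn_of_openAdj ⟨e, ?_, he⟩), conn_of_openAdj ⟨f, ?_, hf⟩⟩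
    · simp [hX, upd2]
    · simp [hX, upd2, Function.update_of_ne hef.symm]
  -- the probe kernel, split into a pointwise part and the two two-copy kernels
  set c : Config E → R := fun x =>
    if (S (X x)).q' = true then (0 : R) else ((pdB (S (X x)) : ℤ) : R) * 2 with hc
  set P0 : Config E → Config E → Config E → R := fun x y w =>
    if (S (X x)).q' = true then (0 : R) else
      ((lbP1 (S (X x)) (S (Y y)) (S (Y w)) + pdB (S (X x)) * (2 * lbA (S (Y y)) (S (Y w))) : ℤ) : R)
    with hP0
  set Pc : Config E → Config E → Config E → R := fun x y w =>
    c x * ((crossB (S (Y y)) (S (Y w)) : ℤ) : R) with hPc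
  set Ps : Config E → Config E → Config E → R := fun x y w =>
    c x * ((sameB (S (Y y)) (S (Y w)) : ℤ) : R) with hPs
  have hprobe : typedCount F₂ z₂ τ (fun x y w => ((KBsym (S (X x)) (S (Y y)) (S (Y w)) : ℤ) : R)) =
      typedCount F₂ z₂ τ (fun x y w => P0 x y w + Pc x y w + Ps x y w) := by
    refine typedCount_congr_K_on _ _ _ fun x y w hxyw _ => ?_
    have hy := hiso y fun e' he' => (hxyw e' he').2.1
    have hw := hiso w fun e' he' => (hxyw e' he').2.2
    rw [KBsym_eq_probe_isolated _ _ _ hy hw]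
    simp only [hP0, hPc, hPs, hc]
    by_cases hq : (S (X x)).q' = true
    · rw [probeB_q' _ _ _ hq]
      simp [hq]
    · have hq' : (S (X x)).q' = false := by simpa using hq
      obtain ⟨h1, h2⟩ := hconnX x
      have hbits := st_lb_bits ends o a₁ a₂ a₃ b (X x) h1 h2 hq'
      rw [probeB_lb _ _ _ hbits (st_consistent ends o a₁ a₂ a₃ b (Y y))
        (st_consistent ends o a₁ a₂ a₃ b (Y w))]
      simp only [hq]
      push_cast
      ring
  have c_nonneg : ∀ x : Config E, 0 ≤ c x := by
    intro x
    simp only [hc]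
    split_ifs
    · exact le_rfl
    · exact mul_nonneg (by exact_mod_cast pdB_nonneg _) (by norm_num)
  -- the support facts for the spectator decomposition
  have heF₂ : e ∉ F₂ := fun h => Finset.notMem_erase e F (Finset.mem_of_mem_erase h)
  have hfF₂ : f ∉ F₂ := Finset.notMem_erase f _
  have hYfix : ∀ (x y : Config E), (∀ e', e' ∉ specFree F₂ τ x → y e' = specPin F₂ z₂ τ x e') →
      Y y = y ∧ Y (flipOn (specFree F₂ τ x) y) = flipOn (specFree F₂ τ x) y := by
    intro x y hy
    have heG : e ∉ specFree F₂ τ x := fun h => heF₂ (specFree_subset F₂ τ x h)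
    have hfG : f ∉ specFree F₂ τ x := fun h => hfF₂ (specFree_subset F₂ τ x h)
    have hye : y e = false := by
      rw [hy e heG, specPin_of_notMem heF₂, hz₂, Function.update_of_ne hef, Function.update_self]
    have hyf : y f = false := by
      rw [hy f hfG, specPin_of_notMem hfF₂, hz₂, Function.update_self]
    have u1 : Function.update y f false = y := Function.update_eq_self_iff.2 hyf.symm
    have u2 : Function.update y e false = y := Function.update_eq_self_iff.2 hye.symm
    have u3 : Function.update (flipOn (specFree F₂ τ x) y) f false = flipOn (specFree F₂ τ x) y :=
      Function.update_eq_self_iff.2 (by rw [flipOn_of_notMem _ _ hfG]; exact hyf.symm)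
    have u4 : Function.update (flipOn (specFree F₂ τ x) y) e false = flipOn (specFree F₂ τ x) y :=
      Function.update_eq_self_iff.2 (by rw [flipOn_of_notMem _ _ heG]; exact hye.symm)
    constructor
    · simp only [hY, upd2]
      rw [u1, u2]
    · simp only [hY, upd2]
      rw [u3, u4]
  -- assemble
  rw [← mul_nonneg_iff_of_pos_left (show (0 : R) < 2 by norm_num), hD, hsym, hprobe,
    typedCount_add, typedCount_add]
  refine add_nonneg (add_nonneg ?_ ?_) ?_
  · refine typedCount_nonneg_of_nonneg _ _ _ _ fun x y w => ?_
    simp only [hP0]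
    split_ifs
    · exact le_rfl
    · exact_mod_cast add_nonneg (lbP1_nonneg _ _ _)
        (mul_nonneg (pdB_nonneg _) (mul_nonneg (by norm_num) (lbA_nonneg _ _)))
  · rw [typedCount_eq_sum_spec F₂ z₂ τ hτ₂]
    refine Finset.sum_nonneg fun x _ => ?_
    split_ifs with hx
    · have hpc : pinnedCount (specFree F₂ τ x) (specPin F₂ z₂ τ x) (Pc x) =
          c x * pinnedCount (specFree F₂ τ x) (specPin F₂ z₂ τ x)
            (crossKernel (R := R) ends a₁ a₂ b a₃) := by
        simp only [hPc]
        rw [pinnedCount_const_mul]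
        congr 1
        refine pinnedCount_congr_on _ _ _ _ fun y hy => ?_
        obtain ⟨h1, h2⟩ := hYfix x y hy
        rw [h1, h2, crossKernel_eq_crossB ends o a₁ a₂ a₃ b, ← hSt]
      rw [hpc]
      exact mul_nonneg (c_nonneg x) (hC _ _)
    · exact le_rfl
  · rw [typedCount_eq_sum_spec F₂ z₂ τ hτ₂]
    refine Finset.sum_nonneg fun x _ => ?_
    split_ifs with hx
    · have hpc : pinnedCount (specFree F₂ τ x) (specPin F₂ z₂ τ x) (Ps x) =
          c x * pinnedCount (specFree F₂ τ x) (specPin F₂ z₂ τ x)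
            (sameKernel (R := R) ends a₂ a₁ b a₃) := by
        simp only [hPs]
        rw [pinnedCount_const_mul]
        congr 1
        refine pinnedCount_congr_on _ _ _ _ fun y hy => ?_
        obtain ⟨h1, h2⟩ := hYfix x y hy
        rw [h1, h2, sameKernel_eq_sameB ends o a₁ a₂ a₃ b, ← hSt]
      rw [hpc]
      exact mul_nonneg (c_nonneg x) (hS _ _)
    · exact le_rfl

/-- **Superadditivity at `o ~ {a₁, b}` from the two-copy rows**: under `CrossCount a₁ a₂ b a₃` and
`SameCount a₂ a₁ b a₃`, `2 N_τ(F ∖ e) + 2 N_τ(F ∖ f) ≤ N_τ` — the (TRI-oM) content at a mark `o`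
of typed degree two attached to `a₁` and `b` (NIGHT3-CERT.md §25.6–25.7). -/
theorem superadditivity_lb_of_rows {e f : E} (he : ends e = s(o, a₁)) (hf : ends f = s(o, b))
    (hef : e ≠ f) (ho1 : o ≠ a₁) (ho2 : o ≠ a₂) (ho3 : o ≠ a₃) (hob : o ≠ b)
    (F : Finset E) (heF : e ∈ F) (hfF : f ∈ F) (z : Config E) (τ : E → ℕ)
    (hτ : ∀ e' ∈ F, τ e' = 1 ∨ τ e' = 2) (hτe : τ e = 1) (hτf : τ f = 1)
    (hcl : ∀ e', e' ≠ e → e' ≠ f → o ∈ ends e' → e' ∉ F ∧ z e' = false)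
    (hC : CrossCount R ends a₁ a₂ b a₃) (hS : SameCount (R := R) ends a₂ a₁ b a₃) :
    2 * typedCount (F.erase e) (Function.update z e false) τ
        (K3 ends o a₁ a₂ a₃ b : Config E → Config E → Config E → R) +
      2 * typedCount (F.erase f) (Function.update z f false) τ (K3 ends o a₁ a₂ a₃ b) ≤
      typedCount F z τ (K3 ends o a₁ a₂ a₃ b : Config E → Config E → Config E → R) :=
  (doubleClass_nonneg_iff (R := R) ends o a₁ a₂ a₃ b he hf ho1 hob hef ho1 ho2 ho3 hob F heF hfF z
    τ hτe hτf hcl).1 (doubleClass_lb_nonneg_of_rows ends o a₁ a₂ a₃ b he hf hef ho1 ho2 ho3 hob F z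
    τ hτ hcl hC hS)

end Main

end TypedRed

end CovForm

end Summit.Ventures.PercRepro2
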